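import Literature.AnabelianGeometry.AbsoluteAnabelian.MonoidKummerLimitGroup
import Literature.AnabelianGeometry.AbsoluteAnabelian.MonoidKummerEquivariantModel
import Literature.AnabelianGeometry.EtaleTheta.KummerEquivarianceInner

/-!
# [AbsTopIII] Prop 3.2 (ii) at the model: the two packagings of `M_TM → lim→ H¹(·, μ_Ẑ(M_TM))` AGREE
# (comparison `lim→_N H¹(ε_k⁻¹N, Λ(k̄ˣ)) → lim→_J H¹(J, Λ(k̄ˣ))`; proof + one comparison map; abc-iut cell)

S. Mochizuki, *Topics in absolute anabelian geometry III*, §3, Proposition 3.2 (ii) p. 71 (bib key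
`MochizukiAbsTopIII2015`).  Two packagings of the Kummer map of the model `TM`-pair `(Π_k ↷ 𝒪_k̄^▷)` now
exist side by side:

* `MonoidKummerLimitGroup.lean`: abc-iut-L4-t2's interface `ContCohomologyData.H1Lim` — indexed by ALL open
  subgroups `J ⊆ Π_k` — made into the group `H1LimGrp`, with `MonoidKummerTheory.kummerHom : 𝒪_k̄^▷ →*
  Multiplicative H1LimGrp` (for the model: `(D.kummerTheory C).kummerHom`);
* `MonoidKummerEquivariantModel.lean`: L2's `H1Colimit` over the sub-system of the PREIMAGES `ε_k⁻¹N` of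
  the open normal `N ⊆ G_k`, `cohColim C D`, with its `Π_k`-action and `constantsKummerHom : 𝒪_k̄^▷ →*
  Multiplicative (cohColim C D)`.

Both are built on the SAME level-wise groups `H¹(H, Λ(k̄ˣ))` (Mathlib `groupCohomology.H1` of L2-t3's
`cyclotomeRep`) and the SAME Kummer classes (`EtaleTheta.kummerClass`).  THIS FILE records the comparison:
the canonical homomorphism `cohColimToLimGrp : cohColim C D →+ (D.kummerTheory C).coh.H1LimGrp` (structure
maps of the sub-system viewed in the full direct limit — DEFINED by the universal property) carries the one
Kummer map to the other (`cohColimToLimGrp_unitsKummer`, `toAdd_kummerHom_eq`), and is INJECTIVE on the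
Kummer image; hence nothing depends on which packaging a consumer picks.  COMPLEMENT: the `Π_k`-action
`cohLimConj` on the ambient module KILLS `ker ε_k` (`cohLimConj_eq_one_of_mem_ker`; inner automorphisms from a
level act trivially on that level's `H¹`, `KummerEquivarianceInner.lean`), i.e. "the natural conjugation
action by `Π_X(M^Θ_*)`" on the constants is an action of `G_k = Π_k / ker ε_k`.  HONEST FRAMING:
bookkeeping over OUR constructions of classical Kummer theory; nothing here bears on [IUTchIII] Cor. 3.12.
-/

noncomputable section

namespace Literature.AnabelianGeometry.AbsoluteAnabelian

open Literature.AnabelianGeometry.EtaleTheta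

variable (C : MLFClosure.{0}) (D : ModelMLFGaloisData C.k C.K)

namespace ModelMLFGaloisData

/-- A member `ε_k⁻¹(N_i)` of the sub-system as an OPEN subgroup of `Π_k` (an index of the full direct
limit). [cite: MochizukiAbsTopIII2015, Proposition 3.2 (ii) p.71] -/
def galNormalOpen (i : GalNormalIdx C) : OpenSubgroup D.Pi :=
  ⟨D.galNormalSystem C i, D.isOpen_galNormalSystem C i⟩

/-- The underlying subgroup of `galNormalOpen i` is the system member. [cite: MochizukiAbsTopIII2015, Proposition 3.2 (ii) p.71] -/
@[simp] theorem coe_galNormalOpen (i : GalNormalIdx C) :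
    ((D.galNormalOpen C i : OpenSubgroup D.Pi) : Subgroup D.Pi) = D.galNormalSystem C i := rfl

/-- The sub-system's order in `OpenSubgroup Π_k`: `i ≤ j` gives `ε_k⁻¹N_j ≤ ε_k⁻¹N_i`.
[cite: MochizukiAbsTopIII2015, Proposition 3.2 (ii) p.71] -/
theorem galNormalOpen_le {i j : GalNormalIdx C} (hij : i ≤ j) : D.galNormalOpen C j ≤ D.galNormalOpen C i :=
  OpenSubgroup.toSubgroup_le.mp (D.galNormalSystem_anti C hij)

/-- The interface restriction maps of the model ARE L2's `resH1` (definitional unfolding of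
`ModelMLFGaloisData.kummerCohomology`). [cite: MochizukiAbsTopIII2015, Proposition 3.2 (ii) p.71] -/
theorem coh_res_apply {H J : OpenSubgroup D.tmPair.Pi} (h : J ≤ H) (x : (D.kummerTheory C).coh.H1 H) :
    (D.kummerTheory C).coh.res h x = resH1 (A := (C.K)ˣ) (OpenSubgroup.toSubgroup_le.mpr h) x := rfl

/-- Compatibility of the structure maps `ofGrp` of the full limit with the transition maps of the sub-system.
[cite: MochizukiAbsTopIII2015, Proposition 3.2 (ii) p.71] -/
theorem ofGrp_H1System {i j : GalNormalIdx C} (hij : i ≤ j)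
    (x : groupCohomology.H1 (cyclotomeRep (A := (C.K)ˣ) (D.galNormalSystem C i))) :
    (D.kummerTheory C).coh.ofGrp (D.galNormalOpen C j)
        (H1System (A := (C.K)ˣ) (D.galNormalSystem C) (D.galNormalSystem_anti C) i j hij x) =
      (D.kummerTheory C).coh.ofGrp (D.galNormalOpen C i) x := by
  have e := (D.kummerTheory C).coh.ofGrp_res (D.galNormalOpen_le C hij) x
  rw [coh_res_apply] at e
  exact e

/-- **The comparison map** `lim→_N H¹(ε_k⁻¹N, Λ(k̄ˣ)) → lim→_J H¹(J, Λ(k̄ˣ))` (sub-system colimit → full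
group-structured direct limit of the interface), by the universal property: a level `ε_k⁻¹N` is sent by the
structure map `ofGrp` of the full limit. [cite: MochizukiAbsTopIII2015, Proposition 3.2 (ii) p.71] -/
def cohColimToLimGrp : cohColim C D →+ (D.kummerTheory C).coh.H1LimGrp :=
  AddCommGroup.DirectLimit.lift
    (fun i => groupCohomology.H1 (cyclotomeRep (A := (C.K)ˣ) (D.galNormalSystem C i)))
    (H1System (A := (C.K)ˣ) (D.galNormalSystem C) (D.galNormalSystem_anti C)) _
    (fun i => ((D.kummerTheory C).coh.ofGrp (D.galNormalOpen C i) :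
      groupCohomology.H1 (cyclotomeRep (A := (C.K)ˣ) (D.galNormalSystem C i)) →+
        (D.kummerTheory C).coh.H1LimGrp))
    (fun _ _ hij x => D.ofGrp_H1System C hij x)

/-- The comparison map on the image of a level class. [cite: MochizukiAbsTopIII2015, Proposition 3.2 (ii) p.71] -/
theorem cohColimToLimGrp_toColimit (i : GalNormalIdx C)
    (x : groupCohomology.H1 (cyclotomeRep (A := (C.K)ˣ) (D.galNormalSystem C i))) :
    D.cohColimToLimGrp C (toColimit (D.galNormalSystem C) (D.galNormalSystem_anti C) i x) =
      (D.kummerTheory C).coh.ofGrp (D.galNormalOpen C i) x :=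
  AddCommGroup.DirectLimit.lift_of
    (G := fun i => groupCohomology.H1 (cyclotomeRep (A := (C.K)ˣ) (D.galNormalSystem C i)))
    (f := H1System (A := (C.K)ˣ) (D.galNormalSystem C) (D.galNormalSystem_anti C)) _ _ _ i x

/-- **The two Kummer maps agree**: the comparison map carries the sub-system Kummer class of a unit
`u = toUnit m` to the interface Kummer class `kummerGrp m` (both are the class of `κ_{ε_k⁻¹N}(m)` at a level
fixing `m`). [cite: MochizukiAbsTopIII2015, Proposition 3.2 (ii) p.71] -/
theorem cohColimToLimGrp_unitsKummer (m : nonzeroIntegers C.k C.K) :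
    D.cohColimToLimGrp C (D.unitsKummer C (toUnit m)) = (D.kummerTheory C).kummerGrp m := by
  obtain ⟨i, hi⟩ := D.isExhausted_units C (toUnit m)
  have hm : ∀ h : D.galNormalOpen C i, (h : D.Pi) • m = m := fun h =>
    toUnit_injective (by rw [← D.smul_toUnit]; exact hi ⟨h.1, h.2⟩)
  rw [unitsKummer, kummerMap_eq_of (D.galNormalSystem_anti C) (D.isExhausted_units C) (toUnit m) i hi,
    cohColimToLimGrp_toColimit, (D.kummerTheory C).kummerGrp_eq_ofGrp m (D.galNormalOpen C i) hm,
    kummerTheory_kummer]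
  rfl

/-- In multiplicative notation: `kummerHom` of the interface packaging = comparison ∘ `constantsKummerHom`
of the sub-system packaging. [cite: MochizukiAbsTopIII2015, Proposition 3.2 (ii) p.71] -/
theorem toAdd_kummerHom_eq (m : nonzeroIntegers C.k C.K) :
    Multiplicative.toAdd ((D.kummerTheory C).kummerHom m) =
      D.cohColimToLimGrp C (Multiplicative.toAdd (D.constantsKummerHom C m)) := by
  rw [constantsKummerHom_apply, toAdd_ofAdd, cohColimToLimGrp_unitsKummer]
  rfl

/-- The comparison map is INJECTIVE on the Kummer image of `k̄ˣ` whenever `ε_k` is an open map (both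
packaged Kummer maps being injective there); in particular the two packagings define the "same" monoid of
constants. [cite: MochizukiAbsTopIII2015, Proposition 3.2 (ii) p.71] -/
theorem cohColimToLimGrp_injOn_kummer (hε : IsOpenMap D.aug) :
    Set.InjOn (D.cohColimToLimGrp C) (Set.range fun m : nonzeroIntegers C.k C.K => D.unitsKummer C (toUnit m)) := by
  rintro _ ⟨m, rfl⟩ _ ⟨m', rfl⟩ h
  rw [cohColimToLimGrp_unitsKummer, cohColimToLimGrp_unitsKummer] at h
  have h' : (D.kummerTheory C).kummerHom m = (D.kummerTheory C).kummerHom m' := congrArg Multiplicative.ofAdd h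
  rw [D.kummerHom_injective C hε h']

/-- **The `Π_k`-action on the ambient module factors through `G_k`**: every `g ∈ ker ε_k` acts as the
identity on `cohLim C D = Multiplicative (lim→_N H¹(ε_k⁻¹N, Λ(k̄ˣ)))` (it lies in every `ε_k⁻¹N` and inner
automorphisms from a level act trivially on that level's `H¹`).
[cite: MochizukiAbsTopIII2015, Proposition 3.2 (ii) p.71] -/
theorem cohLimConj_eq_one_of_mem_ker {g : D.Pi} (hg : g ∈ D.aug.ker) : D.cohLimConj C g = 1 :=
  CoMorphism.conjColimMulAut_eq_one_of_forall_mem (A := (C.K)ˣ) (D.galNormalSystem C)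
    (D.galNormalSystem_anti C) fun i =>
      (D.mem_galNormalSystem_iff C i g).mpr (by rw [MonoidHom.mem_ker.mp hg]; exact Subgroup.one_mem _)

end ModelMLFGaloisData

end Literature.AnabelianGeometry.AbsoluteAnabelian

end
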